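import Summits.Ventures.PercRepro.ThetaSigma
import Summits.Ventures.PercRepro.ThetaMultiProjStep

/-!
# (Σ): the projection at a point, the credit, and the weak split step

Dossier proofs/MINE1-theoremS.md, Addendum 76 (mine-1, gen 39). For a (Σ)-instance `X` on `U`
and a point `e ∈ U`, the **projection** `projS e X = {x ∖ e : x ∈ X}` merges the partner pairs
`x, x + e` (`partS e X`), and the (Σ)-family splits by `e` exactly as in the Marica–Schönheim
bookkeeping ((L1) of Theorem S; ThetaMultiProjStep.lean for (Θ_∞)):

* `card_sigmaD_projS_add_card_creditS_le` — **the exact step**: with the **credit**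
  `creditS U e X = {d ∈ sigmaD U X : e ∉ d, d + e ∈ sigmaD U X}` (the `e`-edges of the family),
  `|sigmaD (U ∖ e) (projS e X)| + |creditS U e X| ≤ |sigmaD U X|` for every point `e` (no
  validity, no consistency);
* `card_projS_add_card_partS` — `|projS e X| + |partS e X| = |X|`;
* `card_le_card_sigmaD_of_projS` — **the weak split step**: if (Σ) holds on `U ∖ e` for the
  projection and the partners are paid by the credit, `|partS e X| ≤ |creditS U e X|`, then
  `|X| ≤ |sigmaD U X|` — the partner family never needs its own inequality;
* `sigmaD_partS_subset_insert_empty_creditS` — **the credit containment**: the (Σ)-family of the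
  partner family lies in the credit together with `∅` (at every point), so the credit is at least
  `|sigmaD (U ∖ e) (partS e X)| − 1`, and at least that family when `{e} ∈ sigmaD U X`
  (`card_partS_le_card_creditS_of`);
* `sigmaValidRel_projS`, `sigmaValidRel_partS` — validity transport: the partner family is always
  valid, the projection exactly at a **sign-consistent** point (`SigmaConsistentAt U e X`: no two
  members project to relative complements — no co-pair `x ⊔ y = U ∖ e`, no co-co-pair
  `x ∪ y = U, x ∩ y = {e}`);
* `SigmaReducible`, `card_le_card_sigmaD_of_sigmaReducible`, `conjSigma_of_sigmaReducible` — (Σ)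
  on every valid instance reducible along consistent points whose partners are paid by the credit.
-/

namespace PercRepro.MSTight

open Finset
open scoped FinsetFamily

variable {α : Type*} [DecidableEq α] [Fintype α]

section ProjDefs

/-- The projection of a (Σ)-instance at `e`. -/
def projS (e : α) (X : Finset (Finset α)) : Finset (Finset α) := X.image fun x => x.erase e

/-- The partner family at `e`: the `e`-free members whose `e`-extension is a member. -/
def partS (e : α) (X : Finset (Finset α)) : Finset (Finset α) :=
  X.filter fun x => e ∉ x ∧ insert e x ∈ X

/-- The **credit** at `e`: the `e`-free members of the family whose `e`-extension is a member too
(the `e`-edges of `sigmaD U X`). -/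
def creditS (U : Finset α) (e : α) (X : Finset (Finset α)) : Finset (Finset α) :=
  (sigmaD U X).filter fun d => e ∉ d ∧ insert e d ∈ sigmaD U X

/-- **Sign-consistency** of the point `e`: no two members project to relative complements in
`U ∖ e`. -/
def SigmaConsistentAt (U : Finset α) (e : α) (X : Finset (Finset α)) : Prop :=
  ∀ x ∈ X, ∀ y ∈ X, (U.erase e) \ x.erase e ≠ y.erase e

variable {U : Finset α} {e : α} {X : Finset (Finset α)}

omit [Fintype α] in
/-- Membership in the projection. -/
theorem mem_projS {z : Finset α} : z ∈ projS e X ↔ ∃ x ∈ X, x.erase e = z := by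
  unfold projS
  simp only [mem_image]

omit [Fintype α] in
/-- Membership in the partner family. -/
theorem mem_partS {z : Finset α} : z ∈ partS e X ↔ z ∈ X ∧ e ∉ z ∧ insert e z ∈ X := by
  unfold partS
  simp only [mem_filter]

omit [Fintype α] in
/-- Membership in the credit. -/
theorem mem_creditS {d : Finset α} :
    d ∈ creditS U e X ↔ d ∈ sigmaD U X ∧ e ∉ d ∧ insert e d ∈ sigmaD U X := by
  unfold creditS
  simp only [mem_filter]

omit [Fintype α] in
/-- `|projS e X| + |partS e X| = |X|` (the one-class count of ThetaMultiRel.lean). -/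
theorem card_projS_add_card_partS : (projS e X).card + (partS e X).card = X.card :=
  card_projE_add_card_partE (A := fun _ : Unit => X) ()

end ProjDefs

section ProjStep

variable {U : Finset α} {e : α} {X : Finset (Finset α)}

omit [Fintype α] in
/-- The projected family lies in the projection of `sigmaD U X`. -/
theorem exists_erase_eq_of_mem_sigmaD_projS {E' : Finset α}
    (h : E' ∈ sigmaD (U.erase e) (projS e X)) : ∃ E ∈ sigmaD U X, E.erase e = E' := by
  rw [mem_sigmaD] at h
  rcases h with rfl | ⟨x', hx', y', hy', hxy', rfl⟩ | ⟨x', hx', y', hy', hxy', rfl⟩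
  · exact ⟨∅, empty_mem_sigmaD U X, erase_empty e⟩
  · obtain ⟨x, hx, rfl⟩ := mem_projS.1 hx'
    obtain ⟨y, hy, rfl⟩ := mem_projS.1 hy'
    exact ⟨x ⊓ y, inf_mem_sigmaD (fun h => hxy' (h ▸ rfl)) hx hy, (erase_inf_erase' x y).symm⟩
  · obtain ⟨x, hx, rfl⟩ := mem_projS.1 hx'
    obtain ⟨y, hy, rfl⟩ := mem_projS.1 hy'
    exact ⟨U \ (x ⊔ y), sdiff_sup_mem_sigmaD (fun h => hxy' (h ▸ rfl)) hx hy,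
      (erase_sdiff_sup_erase' U x y).symm⟩

omit [Fintype α] in
/-- **The exact step**: for every point `e`,
`|sigmaD (U ∖ e) (projS e X)| + |creditS U e X| ≤ |sigmaD U X|`. -/
theorem card_sigmaD_projS_add_card_creditS_le :
    (sigmaD (U.erase e) (projS e X)).card + (creditS U e X).card ≤ (sigmaD U X).card := by
  set D := sigmaD U X with hD
  set De' := (D.filter fun E => e ∈ E).image fun E => E.erase e with hDe'
  set Dn := D.filter fun E => e ∉ E with hDn
  have hsplit : D.card = (D.filter fun E => e ∈ E).card + Dn.card :=
    (card_filter_add_card_filter_not (s := D) fun E => e ∈ E).symm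
  have hP : sigmaD (U.erase e) (projS e X) ⊆ De' ∪ Dn := by
    intro E' hE'
    obtain ⟨E, hE, rfl⟩ := exists_erase_eq_of_mem_sigmaD_projS hE'
    rw [mem_union]
    by_cases he : e ∈ E
    · exact Or.inl (mem_image.2 ⟨E, mem_filter.2 ⟨hE, he⟩, rfl⟩)
    · rw [erase_eq_of_notMem he]
      exact Or.inr (mem_filter.2 ⟨hE, he⟩)
  have hC : creditS U e X ⊆ De' ∩ Dn := by
    intro d hd
    obtain ⟨h1, h2, h3⟩ := mem_creditS.1 hd
    rw [mem_inter]
    exact ⟨mem_image.2 ⟨insert e d, mem_filter.2 ⟨h3, mem_insert_self e d⟩, erase_insert h2⟩,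
      mem_filter.2 ⟨h1, h2⟩⟩
  calc (sigmaD (U.erase e) (projS e X)).card + (creditS U e X).card
      ≤ (De' ∪ Dn).card + (De' ∩ Dn).card := Nat.add_le_add (card_le_card hP) (card_le_card hC)
    _ = De'.card + Dn.card := card_union_add_card_inter _ _
    _ = D.card := by rw [hDe', card_filter_mem_image_erase, hsplit]

omit [Fintype α] in
/-- **The weak split step**: (Σ) on `U ∖ e` for the projection, and partners paid by the credit,
give (Σ) on `U` for `X`. -/
theorem card_le_card_sigmaD_of_projS
    (hP : (projS e X).card ≤ (sigmaD (U.erase e) (projS e X)).card)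
    (hK : (partS e X).card ≤ (creditS U e X).card) : X.card ≤ (sigmaD U X).card :=
  calc X.card = (projS e X).card + (partS e X).card := card_projS_add_card_partS.symm
    _ ≤ (sigmaD (U.erase e) (projS e X)).card + (creditS U e X).card := Nat.add_le_add hP hK
    _ ≤ (sigmaD U X).card := card_sigmaD_projS_add_card_creditS_le

end ProjStep

section Credit

variable {U : Finset α} {e : α} {X : Finset (Finset α)}

omit [Fintype α] in
/-- **The credit containment**: at every point `e ∈ U`, the (Σ)-family of the partner family lies
in the credit together with `∅` — the meet of two partners is the meet of their `e`-free copies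
and, with `e`, of their `e`-copies; likewise the co-joins. -/
theorem sigmaD_partS_subset_insert_empty_creditS (hU : e ∈ U) :
    sigmaD (U.erase e) (partS e X) ⊆ insert ∅ (creditS U e X) := by
  intro E' hE'
  rw [mem_sigmaD] at hE'
  rcases hE' with rfl | ⟨z, hz, w, hw, hzw, rfl⟩ | ⟨z, hz, w, hw, hzw, rfl⟩
  · exact mem_insert_self _ _
  · obtain ⟨hzX, hez, hzeX⟩ := mem_partS.1 hz
    obtain ⟨hwX, hew, hweX⟩ := mem_partS.1 hw
    refine mem_insert_of_mem (mem_creditS.2 ⟨inf_mem_sigmaD hzw hzX hwX,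
      fun hh => hez (mem_inter.1 hh).1, ?_⟩)
    have hm := inf_mem_sigmaD (U := U) (x := insert e z) (y := insert e w)
      (fun h => hzw (by
        have h1 : (insert e z).erase e = (insert e w).erase e := by rw [h]
        rwa [erase_insert hez, erase_insert hew] at h1)) hzeX hweX
    rwa [inf_eq_inter, ← insert_inter_distrib, ← inf_eq_inter] at hm
  · obtain ⟨hzX, hez, hzeX⟩ := mem_partS.1 hz
    obtain ⟨hwX, hew, hweX⟩ := mem_partS.1 hw
    have hzw' : (U.erase e) \ (z ⊔ w) = U \ (insert e z ⊔ insert e w) := by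
      ext a
      simp only [sup_eq_union, mem_sdiff, mem_erase, mem_union, mem_insert]
      tauto
    have hi : insert e ((U.erase e) \ (z ⊔ w)) = U \ (z ⊔ w) := by
      ext a
      simp only [sup_eq_union, mem_insert, mem_sdiff, mem_erase, mem_union]
      constructor
      · rintro (rfl | ⟨⟨-, ha⟩, hzw'⟩)
        · exact ⟨hU, fun hh => hh.elim (fun h' => hez h') fun h' => hew h'⟩
        · exact ⟨ha, hzw'⟩
      · rintro ⟨ha, hzw'⟩
        by_cases hae : a = e
        · exact Or.inl hae
        · exact Or.inr ⟨⟨hae, ha⟩, hzw'⟩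
    refine mem_insert_of_mem (mem_creditS.2 ⟨?_, fun hh => (mem_erase.1 (mem_sdiff.1 hh).1).1 rfl,
      ?_⟩)
    · rw [hzw']
      exact sdiff_sup_mem_sigmaD (fun h => hzw (by
        have h1 : (insert e z).erase e = (insert e w).erase e := by rw [h]
        rwa [erase_insert hez, erase_insert hew] at h1)) hzeX hweX
    · rw [hi]
      exact sdiff_sup_mem_sigmaD hzw hzX hwX

omit [Fintype α] in
/-- `∅` is in the credit exactly when `{e}` is in the family. -/
theorem empty_mem_creditS_iff : ∅ ∈ creditS U e X ↔ {e} ∈ sigmaD U X := by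
  rw [mem_creditS]
  simp only [empty_mem_sigmaD, notMem_empty, not_false_eq_true, insert_empty, true_and]

omit [Fintype α] in
/-- **The partners are paid by the credit** as soon as (Σ) holds for the partner family and
either `{e}` is in the family or (Σ) is strict for the partner family. -/
theorem card_partS_le_card_creditS_of (hU : e ∈ U)
    (hK : (partS e X).card ≤ (sigmaD (U.erase e) (partS e X)).card)
    (h : {e} ∈ sigmaD U X ∨ (partS e X).card < (sigmaD (U.erase e) (partS e X)).card) :
    (partS e X).card ≤ (creditS U e X).card := by
  have hsub := sigmaD_partS_subset_insert_empty_creditS (X := X) hU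
  rcases h with h | h
  · have h0 : ∅ ∈ creditS U e X := empty_mem_creditS_iff.2 h
    rw [insert_eq_of_mem h0] at hsub
    exact hK.trans (card_le_card hsub)
  · have := (card_le_card hsub).trans (card_insert_le _ _)
    omega

end Credit

section Validity

variable {U : Finset α} {e : α} {X : Finset (Finset α)}

omit [Fintype α] in
/-- The partner family is inside the instance. -/
theorem partS_subset : partS e X ⊆ X := filter_subset _ _

omit [Fintype α] in
/-- **The partner family of a valid instance is valid** relative to `U ∖ e`. -/
theorem sigmaValidRel_partS (hU : e ∈ U) (hv : SigmaValidRel U X) :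
    SigmaValidRel (U.erase e) (partS e X) := by
  refine ⟨?_, ?_⟩
  · intro z hz
    obtain ⟨hzX, hez, -⟩ := mem_partS.1 hz
    intro a ha
    exact mem_erase.2 ⟨fun h => hez (h ▸ ha), hv.1 z hzX ha⟩
  · rw [disjoint_left]
    intro z hz hzc
    obtain ⟨w, hw, hzw⟩ := mem_complsRel.1 hzc
    obtain ⟨-, -, hzeX⟩ := mem_partS.1 hz
    obtain ⟨hwX, hew, -⟩ := mem_partS.1 hw
    -- `insert e z = U \ w`, a relative complement of the member `w`
    have key : U \ w = insert e z := by
      rw [← hzw]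
      ext a
      simp only [mem_sdiff, mem_insert, mem_erase]
      constructor
      · rintro ⟨ha, haw⟩
        by_cases hae : a = e
        · exact Or.inl hae
        · exact Or.inr ⟨⟨hae, ha⟩, haw⟩
      · rintro (rfl | ⟨⟨-, ha⟩, haw⟩)
        · exact ⟨hU, hew⟩
        · exact ⟨ha, haw⟩
    exact sdiff_notMem_of_sigmaValidRel hv hwX (key ▸ hzeX)

omit [Fintype α] in
/-- **The projection of a valid instance is valid exactly at a sign-consistent point.** -/
theorem sigmaValidRel_projS (hv : SigmaValidRel U X) (hc : SigmaConsistentAt U e X) :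
    SigmaValidRel (U.erase e) (projS e X) := by
  refine ⟨?_, ?_⟩
  · intro z hz
    obtain ⟨x, hx, rfl⟩ := mem_projS.1 hz
    intro a ha
    rw [mem_erase] at ha ⊢
    exact ⟨ha.1, hv.1 x hx ha.2⟩
  · rw [disjoint_left]
    intro z hz hzc
    obtain ⟨x, hx, rfl⟩ := mem_projS.1 hz
    obtain ⟨w, hw, hzw⟩ := mem_complsRel.1 hzc
    obtain ⟨y, hy, rfl⟩ := mem_projS.1 hw
    exact hc y hy x hx hzw

omit [Fintype α] in
/-- A point `e ∈ U` of a valid instance is sign-consistent iff no two members form a **co-pair**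
(`x ⊓ y = ∅`, `x ⊔ y = U ∖ e`) or a **co-co-pair** (`x ⊔ y = U`, `x ⊓ y = {e}`). -/
theorem sigmaConsistentAt_iff (hv : SigmaValidRel U X) :
    SigmaConsistentAt U e X ↔ ∀ x ∈ X, ∀ y ∈ X,
      ¬ (x ⊓ y = ∅ ∧ x ⊔ y = U.erase e) ∧ ¬ (x ⊔ y = U ∧ x ⊓ y = {e}) := by
  constructor
  · intro hc x hx y hy
    refine ⟨fun ⟨h1, h2⟩ => hc x hx y hy ?_, fun ⟨h1, h2⟩ => hc x hx y hy ?_⟩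
    · -- a co-pair: both members are `e`-free and partition `U ∖ e`
      have hex : e ∉ x := fun h => by
        have h' : e ∈ x ⊔ y := mem_union_left y h
        rw [h2] at h'
        exact (mem_erase.1 h').1 rfl
      have hey : e ∉ y := fun h => by
        have h' : e ∈ x ⊔ y := mem_union_right x h
        rw [h2] at h'
        exact (mem_erase.1 h').1 rfl
      rw [erase_eq_of_notMem hex, erase_eq_of_notMem hey, ← h2, sup_eq_union, union_sdiff_left,
        Finset.sdiff_eq_self_iff_disjoint, disjoint_iff_inter_eq_empty, inter_comm]
      rwa [inf_eq_inter] at h1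
    · -- a co-co-pair: both members contain `e`, their `e`-free parts partition `U ∖ e`
      have hex : e ∈ x := by
        have h' : e ∈ x ⊓ y := by rw [h2]; exact mem_singleton_self e
        exact (mem_inter.1 h').1
      ext a
      simp only [mem_sdiff, mem_erase]
      constructor
      · rintro ⟨⟨hae, haU⟩, hax⟩
        refine ⟨hae, ?_⟩
        have : a ∈ x ⊔ y := by rw [h1]; exact haU
        rw [sup_eq_union, mem_union] at this
        exact this.resolve_left fun h => hax ⟨hae, h⟩
      · rintro ⟨hae, hay⟩
        refine ⟨⟨hae, hv.1 y hy hay⟩, fun hh => ?_⟩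
        have : a ∈ x ⊓ y := mem_inter.2 ⟨hh.2, hay⟩
        rw [h2, mem_singleton] at this
        exact hae this
  · intro h x hx y hy hxy
    obtain ⟨h1, h2⟩ := h x hx y hy
    by_cases hex : e ∈ x <;> by_cases hey : e ∈ y
    · -- both contain `e`: a co-co-pair
      refine h2 ⟨?_, ?_⟩
      · ext a
        simp only [sup_eq_union, mem_union]
        refine ⟨fun ha => ha.elim (fun h => hv.1 x hx h) (fun h => hv.1 y hy h), fun ha => ?_⟩
        by_cases hae : a = e
        · exact Or.inl (hae ▸ hex)
        · by_cases hax : a ∈ x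
          · exact Or.inl hax
          · have ha' : a ∈ (U.erase e) \ x.erase e :=
              mem_sdiff.2 ⟨mem_erase.2 ⟨hae, ha⟩, fun hh => hax (mem_erase.1 hh).2⟩
            rw [hxy] at ha'
            exact Or.inr (mem_erase.1 ha').2
      · ext a
        simp only [inf_eq_inter, mem_inter, mem_singleton]
        refine ⟨fun hh => ?_, fun ha => ha ▸ ⟨hex, hey⟩⟩
        by_contra hae
        have h' : a ∈ y.erase e := mem_erase.2 ⟨hae, hh.2⟩
        rw [← hxy] at h'
        exact (mem_sdiff.1 h').2 (mem_erase.2 ⟨hae, hh.1⟩)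
    · -- `e ∈ x`, `e ∉ y`: then `y = U ∖ x`, against validity
      exfalso
      rw [erase_eq_of_notMem hey] at hxy
      have hyx : U \ x = y := by
        rw [← hxy]
        ext a
        simp only [mem_sdiff, mem_erase]
        constructor
        · rintro ⟨ha, hax⟩
          exact ⟨⟨fun hae => hax (hae ▸ hex), ha⟩, fun h => hax h.2⟩
        · rintro ⟨⟨hae, ha⟩, hax⟩
          exact ⟨ha, fun h => hax ⟨hae, h⟩⟩
      exact sdiff_notMem_of_sigmaValidRel hv hx (hyx ▸ hy)
    · -- `e ∉ x`, `e ∈ y`: then `y = U ∖ x`, against validity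
      exfalso
      rw [erase_eq_of_notMem hex] at hxy
      have hyx : U \ x = y := by
        ext a
        simp only [mem_sdiff]
        constructor
        · rintro ⟨ha, hax⟩
          by_cases hae : a = e
          · exact hae ▸ hey
          · have : a ∈ (U.erase e) \ x := mem_sdiff.2 ⟨mem_erase.2 ⟨hae, ha⟩, hax⟩
            rw [hxy] at this
            exact (mem_erase.1 this).2
        · intro hay
          refine ⟨hv.1 y hy hay, fun hax => ?_⟩
          have hae : a ≠ e := fun h => hex (h ▸ hax)
          have : a ∈ y.erase e := mem_erase.2 ⟨hae, hay⟩
          rw [← hxy] at this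
          exact (mem_sdiff.1 this).2 hax
      exact sdiff_notMem_of_sigmaValidRel hv hx (hyx ▸ hy)
    · -- both `e`-free: a co-pair
      rw [erase_eq_of_notMem hex, erase_eq_of_notMem hey] at hxy
      refine h1 ⟨?_, ?_⟩
      · rw [← hxy, inf_eq_inter, inter_sdiff_self]
      · rw [← hxy, sup_eq_union, union_sdiff_self_eq_union]
        exact (union_eq_right.2 fun a ha => mem_erase.2 ⟨fun h => hex (h ▸ ha), hv.1 x hx ha⟩)

end Validity

end PercRepro.MSTight
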